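import Literature.Analysis.FluidPDE.FluidComputer.ThresholdTransfer
import HarnessLib

/-!
# Fluid computer blueprint — the threshold gate: transfer budgets indexed by the ROTOR ANGLE

HONEST FRAMING: low prior, high value-of-information experiment on Tao's machine paradigm; NOT a
claim that NS blows up. Elementary one-sided comparison for the 5-mode circuit `thresholdCircuit`
(`ThresholdGate.lean`) on a forced window (`IsForcedWindow`, `ThresholdTransfer.lean`); nothing is
asserted about any fluid equation and the transfer stage itself remains OPEN.

## Why index by the angle

`ThresholdTransfer.lean` bounds the clock loss on the transfer window by the time-box `νCm²·t`
(`clock_ge_affine`). Calibrated on the ladder numerics (kit j049182) that box is 6–9× larger than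
the actual clock drop, because the trigger is near its maximum `Cm` only briefly: with the observed
`Cm` the box gives `K·(window)/ρ₁ = 0.61 … 0.90` (rate positivity yes, `≥ ρ₁/2` no). The quantity
that the transfer actually consumes is the ROTOR ANGLE `Θ(t) = r∫₀ᵗ c` (the transfer is complete
once `Θ ≈ 2–4.5 rad`), and along it the budgets are LINEAR in `Cm`:

* `clock_ge_angle` — `b(t) ≥ b(0) - (νCm/r)·Θ(t) - δt` (from `∂ₜ(b + (νCm/r)Θ) = εa² + νc(Cm - c) + g ≥ -δ`);
* `carrier_le_angle` — `a(t) ≤ a(0) + (μCm/r + d₀)·Θ(t) + δt` (conduit only `≥ -d₀`: under forcing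
  the conduit may dip below zero by `O(δ)`, and `-rcd ≤ rd₀c = d₀·∂ₜΘ`);
* `rate_ge_angle` — `νb(t) - μa(t) ≥ ρ(0) - ((ν² + μ²)Cm/r + μd₀)·Θ(t) - (ν + μ)δt`;
* `angle_ge_mul` — while `c ≥ c₀`: `Θ(t) ≥ rc₀·t` (the window is SHORT in time: `t ≤ Θ/(rc₀)`);
* `conduit_floor` — with `a, c, ã ≥ 0`: `d(t) ≥ min(d(0), 0) - δt` (the conduit floor `-d₀` consumed by
  `carrier_le_angle`; strict-barrier argument `image_le_of_deriv_right_lt_deriv_boundary`, `η → 0`);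
* `trigger_le_angle` — while `c ≥ c₀ > 0`, `|a| ≤ R`, rate `≤ ρm`: `c(t) ≤ c(0) + (ρm/r + (σR² + δ)/(rc₀))·Θ(t)`
  — exponential growth in time is LINEAR growth in angle, so the trigger ceiling `Cm` is itself an
  interface quantity (`ρm ≤ ν·b_max`; on the ladder `ν b_max/r ≈ 0.4A·c_eq` per radian);
* `rate_ge_half_of_angle` — if `((ν² + μ²)Cm/r + μd₀)·Θm + (ν + μ)δτ ≤ ρ₁/2` and `Θ ≤ Θm` on the window then
  the net rate stays `≥ ρ₁/2` and the trigger stays `≥ c(0) - δt`.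

On the ladder (A = 21: ν = 5.3·10⁴, μ = 1.1·10⁴, r = 6.5·10⁵, Cm = 8.6c_eq, Θ = 2.7, ρ₁ = 1.1·10³)
the angle budget is `((ν² + μ²)Cm/r)Θ/ρ₁ ≈ 0.12`, matching the observed `ν·drop/ρ₁ ≤ 0.10`.
The angle `Θ` is supplied as an auxiliary function with `Θ(0) = 0` and right derivative `r·c` (no
integrals are used). With `trigger_le_angle` the trigger ceiling is bounded by interface quantities too, so what remains
a-priori for the successor is the completion angle `Θm` at which the overdamped drain has converted
the swept energy (observed 1.9–4.5 rad), plus the carrier sign `a ≥ 0` on the window (a conclusion of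
the future transfer bootstrap, not an invariant: the rotor can overshoot after the window); the
conduit floor is `conduit_floor`. [cite: Tao2016AveragedNS, §5.5 Thm 5.3 (5.5) (third window: energy transfer); §1.3 pp. 10–11]
-/

noncomputable section

open Set Filter Topology
open scoped NNReal

namespace Literature.Analysis.FluidPDE.FluidComputer

open Literature.Analysis.FluidPDE.Tao2016AveragedNS Literature.Analysis.ODE

variable {ε σ ν μ r κ δ τ : ℝ} {x : ℝ → Fin 5 → ℝ} {Θ : ℝ → ℝ}

namespace IsForcedWindow

/-- **Clock loss along the rotor angle.** With `Θ(0) = 0`, `∂ₜΘ = r·c` (`r > 0`) and `0 ≤ c ≤ Cm` on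
`[0, τ)`: `b(t) ≥ b(0) - (νCm/r)Θ(t) - δt`. [folklore] -/
theorem clock_ge_angle (h : IsForcedWindow ε σ ν μ r κ δ τ x) (hε : 0 ≤ ε) (hν : 0 ≤ ν)
    (hr : 0 < r) {Cm : ℝ} (hΘ0 : Θ 0 = 0) (hΘc : ContinuousOn Θ (Icc 0 τ))
    (hΘ' : ∀ t ∈ Ico 0 τ, HasDerivWithinAt Θ (r * x t 2) (Ici t) t)
    (hc : ∀ t ∈ Ico 0 τ, 0 ≤ x t 2 ∧ x t 2 ≤ Cm) :
    ∀ t ∈ Icc 0 τ, x 0 1 - ν * Cm / r * Θ t - δ * t ≤ x t 1 := by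
  choose! V hV hVδ using h.defect
  set f : ℝ → ℝ := fun s => x s 1 + ν * Cm / r * Θ s with hf_def
  have hfc : ContinuousOn f (Icc 0 τ) :=
    ((continuous_apply 1).comp_continuousOn h.continuousOn).add (continuousOn_const.mul hΘc)
  have hfd : ∀ s ∈ Ico 0 τ, HasDerivWithinAt f (V s 1 + ν * Cm / r * (r * x s 2)) (Ici s) s :=
    fun s hs => ((hasDerivWithinAt_pi.1 (hV s hs)) 1).add ((hΘ' s hs).const_mul _)
  have hbd : ∀ s ∈ Ico 0 τ, -δ ≤ V s 1 + ν * Cm / r * (r * x s 2) := by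
    intro s hs
    have hg := abs_apply_le_of_norm_le (hVδ s hs) 1
    rw [Pi.sub_apply, thresholdCircuit_apply_one] at hg
    have h1 := (abs_le.1 hg).1
    obtain ⟨hc0, hcC⟩ := hc s hs
    have e0 : ν * Cm / r * (r * x s 2) = ν * Cm * x s 2 := by field_simp
    have e1 : 0 ≤ ε * x s 0 ^ 2 := by positivity
    have e2 : 0 ≤ ν * x s 2 * (Cm - x s 2) := by
      have := sub_nonneg.2 hcC; positivity
    rw [e0]; nlinarith [h1, e1, e2]
  intro t ht
  have := mul_le_sub_of_le_deriv_right hfc hfd hbd t ht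
  simp only [hf_def, hΘ0, mul_zero, add_zero, sub_zero] at this
  linarith

/-- **Carrier gain along the rotor angle.** With `a, b, c ≥ 0`, `d ≥ -d₀`, `c ≤ Cm` on `[0, τ)` and
`Θ` as above: `a(t) ≤ a(0) + (μCm/r + d₀)Θ(t) + δt`. [folklore] -/
theorem carrier_le_angle (h : IsForcedWindow ε σ ν μ r κ δ τ x) (hε : 0 ≤ ε) (hσ : 0 ≤ σ)
    (hμ : 0 ≤ μ) (hr : 0 < r) {Cm d₀ : ℝ} (hΘ0 : Θ 0 = 0) (hΘc : ContinuousOn Θ (Icc 0 τ))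
    (hΘ' : ∀ t ∈ Ico 0 τ, HasDerivWithinAt Θ (r * x t 2) (Ici t) t)
    (ha : ∀ t ∈ Ico 0 τ, 0 ≤ x t 0) (hb : ∀ t ∈ Ico 0 τ, 0 ≤ x t 1)
    (hc : ∀ t ∈ Ico 0 τ, 0 ≤ x t 2 ∧ x t 2 ≤ Cm) (hd : ∀ t ∈ Ico 0 τ, -d₀ ≤ x t 3) :
    ∀ t ∈ Icc 0 τ, x t 0 ≤ x 0 0 + (μ * Cm / r + d₀) * Θ t + δ * t := by
  choose! V hV hVδ using h.defect
  set f : ℝ → ℝ := fun s => x s 0 - (μ * Cm / r + d₀) * Θ s with hf_def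
  have hfc : ContinuousOn f (Icc 0 τ) :=
    ((continuous_apply 0).comp_continuousOn h.continuousOn).sub (continuousOn_const.mul hΘc)
  have hfd : ∀ s ∈ Ico 0 τ,
      HasDerivWithinAt f (V s 0 - (μ * Cm / r + d₀) * (r * x s 2)) (Ici s) s :=
    fun s hs => ((hasDerivWithinAt_pi.1 (hV s hs)) 0).sub ((hΘ' s hs).const_mul _)
  have hbd : ∀ s ∈ Ico 0 τ, V s 0 - (μ * Cm / r + d₀) * (r * x s 2) ≤ δ := by
    intro s hs
    have hg := abs_apply_le_of_norm_le (hVδ s hs) 0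
    rw [Pi.sub_apply, thresholdCircuit_apply_zero] at hg
    have h1 := (abs_le.1 hg).2
    obtain ⟨hc0, hcC⟩ := hc s hs
    have e0 : (μ * Cm / r + d₀) * (r * x s 2) = μ * Cm * x s 2 + r * d₀ * x s 2 := by
      field_simp
    have e1 : 0 ≤ ε * x s 0 * x s 1 := by
      have := ha s hs; have := hb s hs; positivity
    have e2 : 0 ≤ σ * x s 0 * x s 2 := by
      have := ha s hs; positivity
    have e3 : 0 ≤ r * (x s 3 + d₀) * x s 2 := by
      have := hd s hs; have : 0 ≤ x s 3 + d₀ := by linarith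
      have := hr.le; positivity
    have e4 : 0 ≤ μ * x s 2 * (Cm - x s 2) := by
      have := sub_nonneg.2 hcC; positivity
    rw [e0]; nlinarith [h1, e1, e2, e3, e4]
  intro t ht
  have := sub_le_mul_of_deriv_right_le hfc hfd hbd t ht
  simp only [hf_def, hΘ0, mul_zero, sub_zero] at this
  linarith

/-- **Rate persistence along the rotor angle.** Under the hypotheses of the two lemmas above:
`νb(t) - μa(t) ≥ (νb(0) - μa(0)) - ((ν² + μ²)Cm/r + μd₀)Θ(t) - (ν + μ)δt` — the loss is LINEAR in
the trigger ceiling, the conduit floor and the angle the rotor has turned. [folklore] -/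
theorem rate_ge_angle (h : IsForcedWindow ε σ ν μ r κ δ τ x) (hε : 0 ≤ ε) (hσ : 0 ≤ σ)
    (hν : 0 ≤ ν) (hμ : 0 ≤ μ) (hr : 0 < r) {Cm d₀ : ℝ} (hΘ0 : Θ 0 = 0)
    (hΘc : ContinuousOn Θ (Icc 0 τ)) (hΘ' : ∀ t ∈ Ico 0 τ, HasDerivWithinAt Θ (r * x t 2) (Ici t) t)
    (ha : ∀ t ∈ Ico 0 τ, 0 ≤ x t 0) (hb : ∀ t ∈ Ico 0 τ, 0 ≤ x t 1)
    (hc : ∀ t ∈ Ico 0 τ, 0 ≤ x t 2 ∧ x t 2 ≤ Cm) (hd : ∀ t ∈ Ico 0 τ, -d₀ ≤ x t 3) :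
    ∀ t ∈ Icc 0 τ, (ν * x 0 1 - μ * x 0 0) - ((ν ^ 2 + μ ^ 2) * Cm / r + μ * d₀) * Θ t -
        (ν + μ) * δ * t ≤ ν * x t 1 - μ * x t 0 := by
  intro t ht
  have hB := h.clock_ge_angle hε hν hr hΘ0 hΘc hΘ' hc t ht
  have hA := h.carrier_le_angle hε hσ hμ hr hΘ0 hΘc hΘ' ha hb hc hd t ht
  have h1 := mul_le_mul_of_nonneg_left hA hμ
  have h2 := mul_le_mul_of_nonneg_left hB hν
  have e : ((ν ^ 2 + μ ^ 2) * Cm / r + μ * d₀) * Θ t =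
      ν * (ν * Cm / r * Θ t) + μ * ((μ * Cm / r + d₀) * Θ t) := by
    field_simp
    ring
  rw [e]; nlinarith [h1, h2]

/-- **The window is short in time.** While `c ≥ c₀` on `[0, τ)`: `Θ(t) ≥ rc₀·t`. [folklore] -/
theorem angle_ge_mul (hr : 0 ≤ r) {c₀ : ℝ} (hΘ0 : Θ 0 = 0) (hΘc : ContinuousOn Θ (Icc 0 τ))
    (hΘ' : ∀ t ∈ Ico 0 τ, HasDerivWithinAt Θ (r * x t 2) (Ici t) t)
    (hc : ∀ t ∈ Ico 0 τ, c₀ ≤ x t 2) : ∀ t ∈ Icc 0 τ, r * c₀ * t ≤ Θ t := by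
  intro t ht
  have := mul_le_sub_of_le_deriv_right (M := r * c₀) (f' := fun s => r * x s 2) hΘc hΘ'
    (fun s hs => mul_le_mul_of_nonneg_left (hc s hs) hr) t ht
  simp only [hΘ0, sub_zero] at this
  linarith

/-- **Trigger ceiling along the rotor angle — exponential growth in time is LINEAR growth in
angle.** While `c ≥ c₀ > 0`, `|a| ≤ R` and the net rate is `≤ ρm` on `[0, τ)`:
`c(t) ≤ c(0) + (ρm/r + (σR² + δ)/(rc₀))·Θ(t)`. Indeed `∂ₜ(c - LΘ) = σa² + ρc + g_c - Lrc ≤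
(σR² + δ)(1 - c/c₀) + (ρ - ρm)c ≤ 0` for `L = ρm/r + (σR² + δ)/(rc₀)`. This supplies the trigger
ceiling `Cm` of the lemmas above from interface quantities: `Cm = c(0) + L·Θm`. [folklore] -/
theorem trigger_le_angle (h : IsForcedWindow ε σ ν μ r κ δ τ x) (hσ : 0 ≤ σ) (hr : 0 < r)
    (hδ : 0 ≤ δ) {R ρm c₀ : ℝ} (hc₀ : 0 < c₀) (hΘ0 : Θ 0 = 0)
    (hΘc : ContinuousOn Θ (Icc 0 τ)) (hΘ' : ∀ t ∈ Ico 0 τ, HasDerivWithinAt Θ (r * x t 2) (Ici t) t)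
    (haR : ∀ t ∈ Ico 0 τ, |x t 0| ≤ R) (hρ : ∀ t ∈ Ico 0 τ, ν * x t 1 - μ * x t 0 ≤ ρm)
    (hc : ∀ t ∈ Ico 0 τ, c₀ ≤ x t 2) :
    ∀ t ∈ Icc 0 τ, x t 2 ≤ x 0 2 + (ρm / r + (σ * R ^ 2 + δ) / (r * c₀)) * Θ t := by
  choose! V hV hVδ using h.defect
  set L := ρm / r + (σ * R ^ 2 + δ) / (r * c₀) with hL_def
  set f : ℝ → ℝ := fun s => x s 2 - L * Θ s with hf_def
  have hfc : ContinuousOn f (Icc 0 τ) :=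
    ((continuous_apply 2).comp_continuousOn h.continuousOn).sub (continuousOn_const.mul hΘc)
  have hfd : ∀ s ∈ Ico 0 τ, HasDerivWithinAt f (V s 2 - L * (r * x s 2)) (Ici s) s :=
    fun s hs => ((hasDerivWithinAt_pi.1 (hV s hs)) 2).sub ((hΘ' s hs).const_mul _)
  have hbd : ∀ s ∈ Ico 0 τ, V s 2 - L * (r * x s 2) ≤ 0 := by
    intro s hs
    have hg := abs_apply_le_of_norm_le (hVδ s hs) 2
    rw [Pi.sub_apply, thresholdCircuit_apply_two] at hg
    have h1 := (abs_le.1 hg).2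
    have hcs := hc s hs
    have hc0 : 0 ≤ x s 2 := hc₀.le.trans hcs
    have haa := abs_le.1 (haR s hs)
    have ha2 : x s 0 ^ 2 ≤ R ^ 2 := sq_le_sq' haa.1 haa.2
    have e0 : L * (r * x s 2) = ρm * x s 2 + (σ * R ^ 2 + δ) * (x s 2 / c₀) := by
      simp only [hL_def]; field_simp
    have e1 : 1 ≤ x s 2 / c₀ := by rw [le_div_iff₀ hc₀]; linarith
    have e2 : (ν * x s 1 - μ * x s 0) * x s 2 ≤ ρm * x s 2 :=
      mul_le_mul_of_nonneg_right (hρ s hs) hc0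
    have e3 : σ * x s 0 ^ 2 ≤ σ * R ^ 2 := mul_le_mul_of_nonneg_left ha2 hσ
    have e4 : 0 ≤ σ * R ^ 2 + δ := by positivity
    have e5 : σ * R ^ 2 + δ ≤ (σ * R ^ 2 + δ) * (x s 2 / c₀) := by
      nlinarith [e1, e4]
    rw [e0]; nlinarith [h1, e2, e3, e5]
  intro t ht
  have := sub_le_mul_of_deriv_right_le (M := 0) hfc hfd hbd t ht
  simp only [hf_def, hΘ0, mul_zero, sub_zero, zero_mul] at this
  linarith

/-- **Rate floor from an angle budget.** If the angle stays `≤ Θm` on the window and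
`((ν² + μ²)Cm/r + μd₀)Θm + (ν + μ)δτ ≤ ρ₁/2` with `ρ₁ ≤ ρ(0)`, then `νb - μa ≥ ρ₁/2` on `[0, τ]` and the
trigger obeys `c(t) ≥ c(0) - δt`. [folklore] -/
theorem rate_ge_half_of_angle (h : IsForcedWindow ε σ ν μ r κ δ τ x) (hε : 0 ≤ ε) (hσ : 0 ≤ σ)
    (hν : 0 ≤ ν) (hμ : 0 ≤ μ) (hr : 0 < r) (hδ : 0 ≤ δ) {Cm d₀ Θm ρ₁ : ℝ} (hCm : 0 ≤ Cm)
    (hd₀ : 0 ≤ d₀) (hΘ0 : Θ 0 = 0) (hΘc : ContinuousOn Θ (Icc 0 τ))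
    (hΘ' : ∀ t ∈ Ico 0 τ, HasDerivWithinAt Θ (r * x t 2) (Ici t) t)
    (hΘm : ∀ t ∈ Icc 0 τ, Θ t ≤ Θm) (hρ₁ : ρ₁ ≤ ν * x 0 1 - μ * x 0 0)
    (hwin : ((ν ^ 2 + μ ^ 2) * Cm / r + μ * d₀) * Θm + (ν + μ) * δ * τ ≤ ρ₁ / 2)
    (ha : ∀ t ∈ Ico 0 τ, 0 ≤ x t 0) (hb : ∀ t ∈ Ico 0 τ, 0 ≤ x t 1)
    (hc : ∀ t ∈ Ico 0 τ, 0 ≤ x t 2 ∧ x t 2 ≤ Cm) (hd : ∀ t ∈ Ico 0 τ, -d₀ ≤ x t 3) :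
    (∀ t ∈ Icc 0 τ, ρ₁ / 2 ≤ ν * x t 1 - μ * x t 0) ∧
      ∀ t ∈ Icc 0 τ, x 0 2 - δ * t ≤ x t 2 := by
  have hL : 0 ≤ (ν ^ 2 + μ ^ 2) * Cm / r + μ * d₀ := by positivity
  have hrate : ∀ t ∈ Icc 0 τ, ρ₁ / 2 ≤ ν * x t 1 - μ * x t 0 := by
    intro t ht
    have h1 := h.rate_ge_angle hε hσ hν hμ hr hΘ0 hΘc hΘ' ha hb hc hd t ht
    have h2 : ((ν ^ 2 + μ ^ 2) * Cm / r + μ * d₀) * Θ t ≤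
        ((ν ^ 2 + μ ^ 2) * Cm / r + μ * d₀) * Θm :=
      mul_le_mul_of_nonneg_left (hΘm t ht) hL
    have h3 : (ν + μ) * δ * t ≤ (ν + μ) * δ * τ :=
      mul_le_mul_of_nonneg_left ht.2 (by positivity)
    linarith
  refine ⟨hrate, h.trigger_ge_affine hσ (fun t ht => ?_) (fun t ht => (hc t ht).1)⟩
  have hτ : 0 < τ := ht.1.trans_lt ht.2
  have hΘτ : 0 ≤ Θm := by
    have h0 := hΘm 0 ⟨le_rfl, hτ.le⟩; rw [hΘ0] at h0; exact h0
  have hρpos : 0 ≤ ρ₁ / 2 := by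
    have : 0 ≤ ((ν ^ 2 + μ ^ 2) * Cm / r + μ * d₀) * Θm + (ν + μ) * δ * τ := by positivity
    linarith
  exact hρpos.trans (hrate t (Ico_subset_Icc_self ht))

/-- **Conduit floor (sign persistence up to the forcing).** With `a, c, ã ≥ 0` on `[0, τ)`,
`r, κ, δ ≥ 0`: `d(t) ≥ min(d(0), 0) - δt` on `[0, τ]`. (At a contact `d = m - (δ + η)t ≤ 0` one has
`∂ₜd = rac - κdã + g_d ≥ -δ > -(δ + η)`: a strict barrier for every `η > 0`, then `η → 0`.) This is
the conduit floor `-d₀`, `d₀ = max(0, -d(0)) + δτ`, consumed by `carrier_le_angle`. [folklore] -/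
theorem conduit_floor (h : IsForcedWindow ε σ ν μ r κ δ τ x) (hr : 0 ≤ r) (hκ : 0 ≤ κ)
    (hδ : 0 ≤ δ) (ha : ∀ t ∈ Ico 0 τ, 0 ≤ x t 0) (hc : ∀ t ∈ Ico 0 τ, 0 ≤ x t 2)
    (he : ∀ t ∈ Ico 0 τ, 0 ≤ x t 4) :
    ∀ t ∈ Icc 0 τ, min (x 0 3) 0 - δ * t ≤ x t 3 := by
  choose! V hV hVδ using h.defect
  set m := min (x 0 3) 0 with hm_def
  have hm0 : m ≤ x 0 3 := min_le_left _ _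
  have hm1 : m ≤ 0 := min_le_right _ _
  have hfc : ContinuousOn (fun s => -x s 3) (Icc 0 τ) :=
    ((continuous_apply 3).comp_continuousOn h.continuousOn).neg
  have hfd : ∀ s ∈ Ico 0 τ, HasDerivWithinAt (fun s => -x s 3) (-V s 3) (Ici s) s :=
    fun s hs => ((hasDerivWithinAt_pi.1 (hV s hs)) 3).neg
  -- a strict barrier for every `η > 0`
  have key : ∀ η : ℝ, 0 < η → ∀ t ∈ Icc 0 τ, m - (δ + η) * t ≤ x t 3 := by
    intro η hη t ht
    have hB : ∀ s, HasDerivAt (fun s => -m + (δ + η) * s) (δ + η) s := by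
      intro s
      simpa using ((hasDerivAt_id s).const_mul (δ + η)).const_add (-m)
    have hmain := image_le_of_deriv_right_lt_deriv_boundary hfc hfd
      (B := fun s => -m + (δ + η) * s) (B' := fun _ => δ + η) (by simp [hm0]) hB ?_ ht
    · linarith
    intro s hs heq
    have hds : x s 3 ≤ 0 := by
      have : 0 ≤ (δ + η) * s := mul_nonneg (by linarith) hs.1
      linarith
    have hg := abs_apply_le_of_norm_le (hVδ s hs) 3
    rw [Pi.sub_apply, thresholdCircuit_apply_three] at hg
    have h1 := (abs_le.1 hg).1
    have e1 : 0 ≤ r * x s 0 * x s 2 := by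
      have := ha s hs; have := hc s hs; positivity
    have e2 : κ * x s 3 * x s 4 ≤ 0 := by
      have h4 := he s hs
      have : κ * x s 4 * x s 3 ≤ 0 := mul_nonpos_of_nonneg_of_nonpos (mul_nonneg hκ h4) hds
      linarith [this]
    show -V s 3 < δ + η
    linarith
  intro t ht
  rcases eq_or_lt_of_le ht.1 with h0 | htpos
  · subst h0; simpa using hm0
  · by_contra hcon
    push Not at hcon
    set g := m - δ * t - x t 3 with hg_def
    have hgpos : 0 < g := by linarith
    have hk := key (g / (2 * t)) (by positivity) t ht
    have e : (δ + g / (2 * t)) * t = δ * t + g / 2 := by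
      field_simp
    rw [e] at hk
    linarith

end IsForcedWindow

end Literature.Analysis.FluidPDE.FluidComputer

end
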